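import Summits.RiemannHypothesis.RiemannHypothesis.Theorems.WeilFormatCDeflatedFarIdentify
import HarnessLib

/-!
# Format C, design C∞: the profile images as kernel rows against the profile coefficients

Route context: Fourier–Galerkin / Schur-complement certificates of Weil positivity on a window ("format C";
cell memo `run/shared/lean/pub/rh-explicit/rh-explicit-weil-10/KERNEL-LEVER.md` §17–§18 (the `Uq` clause); supporting
stmt-RiemannHypothesis-0098; seat rh-explicit-weil-10).  The coupling majorant of the deflated certificate needs, for every far
mode `m`, the IMAGE `W_a(u, ψ)` of a profile window `ψ` (or its band part `ψ − proj_B ψ`) against a trigonometric window `u`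
(a block vector or a single `χ_m`).  This file writes these images as limits of KERNEL ROWS against the profile's window
Fourier coefficients — the form in which the (E) side tabulates them (kernel boxes × coefficient boxes + a tail):

* `weilWindowSesq_trig_proj_eq_sum` — `W_a(u, proj_P v) = Σ_{|n|≤P} conj((2a)^{-1/2} ĉ_n(v)) · W_a(u, χ_n)` (finite, exact);
* `tendsto_sum_modes_kernel_row` — for `v` of the summable class: `Σ_{|n|≤P} conj((2a)^{-1/2}ĉ_n(v)) W_a(u, χ_n) → W_a(u, v)`;
* `tendsto_sum_band_kernel_row_indicator` — for an admissible profile window `1f` and `P ≥ B`: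
  `Σ_{n ∈ modes P \ modes B} conj((2a)^{-1/2}ĉ_n(1f)) W_a(u, χ_n) → W_a(u, 1f − proj_B(1f))` — the band image.

With `u = χ_m` and weil-2's `weilWindowSesq_chi = gramCoeff` the kernel rows are Yoshida's printed coefficients.  Pure bookkeeping;
standard axioms; no RH claim.
-/

set_option autoImplicit false
-- `Summit.RiemannHypothesis.RiemannHypothesis.…` is the layout-mandated namespace (summit = problem name).
set_option linter.dupNamespace false

noncomputable section

open Complex Filter Set MeasureTheory
open scoped Real Topology ComplexConjugate

namespace Summit.RiemannHypothesis.RiemannHypothesis.Theorems.WeilFormatC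

open Literature.NumberTheory.LFunctions Literature.NumberTheory.LFunctions.Yoshida1992

variable {a : ℝ}

/-- **A projected window against a trigonometric window is a finite kernel row**:
`W_a(u, proj_P v) = Σ_{|n|≤P} conj((2a)^{-1/2} ĉ_n(v)) · W_a(u, χ_n)` (`a > 0`, `u = Σ_{k∈s} c_k χ_k`). -/
theorem weilWindowSesq_trig_proj_eq_sum (ha : 0 < a) (s : Finset ℤ) (c : ℤ → ℂ) (P : ℕ) (v : ℝ → ℂ) :
    weilWindowSesq a (∑ k ∈ s, c k • chi a k) (proj a P v) =
      ∑ n ∈ modes P, conj ((((1 / Real.sqrt (2 * a) : ℝ) : ℂ)) * Yoshida1992.fourierCoeff a n v) *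
        weilWindowSesq a (∑ k ∈ s, c k • chi a k) (chi a n) := by
  unfold proj
  exact weilWindowSesq_sum_right ha.le (modes P) (fun n _ ↦ isWindowFunction_chi ha n)
    (isWindowFunction_sum_smul_chi ha s c) _ a

/-- **Kernel rows converge to the image** (`a > 0`): for a trigonometric window `u` and a window `v` of the summable class,
`Σ_{|n|≤P} conj((2a)^{-1/2} ĉ_n(v)) W_a(u, χ_n) → W_a(u, v)`. -/
theorem tendsto_sum_modes_kernel_row (ha : 0 < a) (s : Finset ℤ) (c : ℤ → ℂ) {v : ℝ → ℂ}
    (hv : IsWindowFunction a v) (hcv : ContinuousOn v (Icc (-a) a)) (hev : v (-a) = v a)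
    (hsv0 : Summable fun n : ℤ ↦ ‖Yoshida1992.fourierCoeff a n v‖)
    (hsv1 : Summable fun n : ℤ ↦ |(n : ℝ)| ^ 1 * ‖Yoshida1992.fourierCoeff a n v‖) :
    Tendsto (fun P ↦ ∑ n ∈ modes P, conj ((((1 / Real.sqrt (2 * a) : ℝ) : ℂ)) * Yoshida1992.fourierCoeff a n v) *
        weilWindowSesq a (∑ k ∈ s, c k • chi a k) (chi a n)) atTop
      (𝓝 (weilWindowSesq a (∑ k ∈ s, c k • chi a k) v)) := by
  have h := tendsto_weilWindowSesq_trig_proj ha s c hv hcv hev hsv0 hsv1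
  simp_rw [weilWindowSesq_trig_proj_eq_sum ha] at h
  exact h

/-- **The band image as a kernel row over the band** (`a > 0`): for an admissible profile window `1f` (`f ∈ C³`,
`f(−a) = f(a)`, `f′(−a) = f′(a)`) and a trigonometric window `u`,
`Σ_{n ∈ modes P \ modes B} conj((2a)^{-1/2} ĉ_n(1f)) W_a(u, χ_n) → W_a(u, 1f − proj_B(1f))` as `P → ∞`. -/
theorem tendsto_sum_band_kernel_row_indicator (ha : 0 < a) (s : Finset ℤ) (c : ℤ → ℂ) {f : ℝ → ℂ}
    (hf : ContDiff ℝ 3 f) (hfe₀ : f (-a) = f a) (hfe₁ : deriv f (-a) = deriv f a) (B : ℕ) :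
    Tendsto (fun P ↦ ∑ n ∈ modes P \ modes B,
        conj ((((1 / Real.sqrt (2 * a) : ℝ) : ℂ)) * Yoshida1992.fourierCoeff a n ((Icc (-a) a).indicator f)) *
          weilWindowSesq a (∑ k ∈ s, c k • chi a k) (chi a n)) atTop
      (𝓝 (weilWindowSesq a (∑ k ∈ s, c k • chi a k)
        ((Icc (-a) a).indicator f - proj a B ((Icc (-a) a).indicator f)))) := by
  have h := tendsto_weilWindowSesq_trig_band_indicator ha s c hf hfe₀ hfe₁ B
  refine h.congr' ?_
  filter_upwards [eventually_ge_atTop B] with P hP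
  have hsub : modes B ⊆ modes P := fun n hn ↦ by
    rw [mem_modes] at hn ⊢
    exact hn.trans (by exact_mod_cast hP)
  obtain ⟨hv, -, -, -, -⟩ := summableClass_indicator_of_contDiff ha hf hfe₀ hfe₁
  rw [weilWindowSesq_sub_right ha.le (isWindowFunction_sum_smul_chi ha s c) (isWindowFunction_proj ha P _)
      (isWindowFunction_proj ha B _),
    weilWindowSesq_trig_proj_eq_sum ha, weilWindowSesq_trig_proj_eq_sum ha, Finset.sum_sdiff_eq_sub hsub]

end Summit.RiemannHypothesis.RiemannHypothesis.Theorems.WeilFormatC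

end
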